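import Summits.FinalStateConjecture.FinalStateConjecture.Theorems.ZeroEnergyKerrOrBombStationaryLimitReductionRecutCoveringJunctionCore
import Summits.FinalStateConjecture.FinalStateConjecture.Theorems.ZeroEnergyKerrOrBombStationaryLimitReductionKerrIsometryRigidityWave3EndTopology
import Summits.FinalStateConjecture.FinalStateConjecture.Theorems.StarvedNecksNecksCertifyStubSeamSurgeryHelpers
import Literature.Geometry.Lorentzian.KerrHyperboloidalLeaves
import HarnessLib

/-!
# Route ZeroEnergyKerrOrBomb · crux `FinalStateFromKerrOrBomb` (stmt-FinalStateConjecture-17839), line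
# `SketchIdeator1` — stub `stub_recutJunctionCoreCO`, wave 5: under the core's binders NO HOLE TILTS THE TIME AXIS
# (`(Λᵢ⁻¹ e₀)_{space} = 0`) — an honesty finding on the overlap-margin clause (iii) as typed

Helper file (`--supports stmt-FinalStateConjecture-17839`; registered helper `recutJunction_noTilt`) of the lead's
wave-5 stub worker W16 (2026-08-17); companions `…RecutCoreCOFlatSteer.lean` (p146004), `…RecutCoreCOAssembly.lean`,
`…RecutCoreCOIsochronousSign.lean` (the sign: `Λᵢ e₀ = e₀` from this file + (ℓ) + (e′)). See `work/stubs/W16-report.md`.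

THE FINDING. Clause (iii) of `HasExhaustiveDocCharts'` puts, for late rest times `σ`, the chart image of the WHOLE far
shell `{timeᵢ = σ, Aᵢ.radius ≥ Rᵢ(σ − s₀) − W} ∩ docPart` (unbounded above) inside the radiation zone
`Ψ₀(U₀ ∩ {x⁰ > τ₀})`. If the motion of hole `i` tilts the time axis (`ũ := Λᵢ⁻¹ e₀`, `ũ_{sp} ≠ 0`), the lab time
`(Λᵢ w + cᵢ)⁰ = cᵢ⁰ + ũ⁰ σ − ⟪ũ_{sp}, w_{sp}⟫` (§1) is not bounded below on that shell, which then contains a straight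
coordinate segment from a point of the mandatory flat set `{x⁰ > τ₀, radiusⱼ > ρⱼ}` (a d.o.c.-part coordinate of hole
`i` by (e⁺)) to a point of lab time `τ₀`; at the first point `y₀` of the segment that is not a lab-late flat
coordinate — a d.o.c.-part coordinate by the far-closure lemma (§2) — clause (a) before `y₀` and clause (iii) at `y₀`
give `ψᵢ y₀ = lim Ψ₀(y_t) = Ψ₀ ȳ`, and the open-embedding property of `Ψ₀` forces `ȳ = y₀`: contradiction (§3). So with
(iii) as typed plus the chart-overlap clause no hole is boosted; a boost-honest (iii) must bound the shell above.

Elementary; no named fact, nothing restated. Reference: Dafermos–Luk arXiv:1710.01722, Conjecture 1 (b)–(c)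
(late-time multi-chart bookkeeping; formalisation-internal).
-/

set_option linter.dupNamespace false

noncomputable section

open scoped Manifold ContDiff Topology RealInnerProductSpace
open Set Filter Function

namespace Summit.FinalStateConjecture.FinalStateConjecture.Theorems.SymplecticDualOfTheBomb

open Literature.Geometry.Lorentzian Summit.FinalStateConjecture.FinalStateConjecture.Theorems.OneLockedExplosion

/-! ## §1 Lorentz algebra of the lab time -/

section Lorentz

variable (Λ : lorentzGroup)

/-- `η(v, w) = −v⁰ w⁰ + ⟪v_{space}, w_{space}⟫`. [folklore] -/
private theorem minkowski_eq_inner_w5 (v w : E4) :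
    Minkowski.bilin v w = -(v 0 * w 0) + ⟪E4.spatial v, E4.spatial w⟫ := by
  rw [Minkowski.bilin_apply, real_inner_comm, PiLp.inner_apply]
  simp [Fin.sum_univ_three, E4.spatial_apply]

/-- **Lab time through the pulled-back time axis**: `(Λ w)⁰ = ũ⁰ w⁰ − ⟪ũ_{sp}, w_{sp}⟫` with `ũ := Λ⁻¹ e₀`
(`(Λ w)⁰ = −η(e₀, Λ w) = −η(Λ⁻¹ e₀, w)`). [folklore] -/
theorem lorentz_apply_zero_eq (w : E4) :
    (Λ : E4 ≃L[ℝ] E4) w 0 = (Λ : E4 ≃L[ℝ] E4).symm (E4.basisVector 0) 0 * w 0 -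
      ⟪E4.spatial ((Λ : E4 ≃L[ℝ] E4).symm (E4.basisVector 0)), E4.spatial w⟫ := by
  have h := Λ.2 ((Λ : E4 ≃L[ℝ] E4).symm (E4.basisVector 0)) w
  rw [ContinuousLinearEquiv.apply_symm_apply, Minkowski.bilin_basisVector_zero_left, minkowski_eq_inner_w5] at h
  linarith

/-- A vector with `η(m, m) = 1` has spatial norm `≥ 1`. [folklore] -/
theorem one_le_spatialNorm_of_bilin_eq_one {m : E4} (h : Minkowski.bilin m m = 1) : 1 ≤ E4.spatialNorm m := by
  rw [minkowski_eq_inner_w5, real_inner_self_eq_norm_sq] at h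
  have h1 : 1 ≤ E4.spatialNorm m ^ 2 := by rw [E4.spatialNorm]; nlinarith [h, sq_nonneg (m 0)]
  nlinarith [E4.spatialNorm_nonneg m]

/-- `η((0, n), (0, n)) = ‖n‖²`. [folklore] -/
theorem bilin_ofTimeSpace_zero (n : E3) : Minkowski.bilin (E4.ofTimeSpace 0 n) (E4.ofTimeSpace 0 n) = ‖n‖ ^ 2 := by
  rw [minkowski_eq_inner_w5, E4.spatial_ofTimeSpace, real_inner_self_eq_norm_sq, E4.ofTimeSpace_apply_zero]; ring

/-- In `E3` every vector admits a unit vector orthogonal to it (adapted from `exists_norm_eq_one_and_inner_eq_zero`,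
Literature/MathematicalPhysics/KineticTheory/Hilbert6Wave0Proofs). [folklore] -/
theorem exists_norm_eq_one_inner_eq_zero_E3 (e : E3) : ∃ w : E3, ‖w‖ = 1 ∧ ⟪e, w⟫ = 0 := by
  let b := stdOrthonormalBasis ℝ E3
  have hfin : Module.finrank ℝ E3 = 3 := finrank_euclideanSpace_fin
  set e₁ : E3 := b ⟨0, by rw [hfin]; norm_num⟩ with he₁_def
  set e₂ : E3 := b ⟨1, by rw [hfin]; norm_num⟩ with he₂_def
  have he₁ : ‖e₁‖ = 1 := b.norm_eq_one _
  have he₂ : ‖e₂‖ = 1 := b.norm_eq_one _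
  have he₁₂ : ⟪e₁, e₂⟫ = 0 := b.inner_eq_zero (fun h ↦ absurd (congrArg Fin.val h) (by norm_num))
  set u₀ : E3 := ⟪e, e₂⟫ • e₁ - ⟪e, e₁⟫ • e₂ with hu₀
  have horth : ⟪e, u₀⟫ = 0 := by
    rw [hu₀, inner_sub_right, real_inner_smul_right, real_inner_smul_right]; ring
  by_cases h0 : u₀ = 0
  · refine ⟨e₁, he₁, ?_⟩
    have h1 : ⟪u₀, e₂⟫ = -⟪e, e₁⟫ := by
      rw [hu₀, inner_sub_left, real_inner_smul_left, real_inner_smul_left, he₁₂, real_inner_self_eq_norm_sq, he₂]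
      ring
    rw [h0, inner_zero_left] at h1
    linarith
  · refine ⟨‖u₀‖⁻¹ • u₀, ?_, ?_⟩
    · rw [norm_smul, norm_inv, norm_norm, inv_mul_cancel₀ (norm_ne_zero_iff.mpr h0)]
    · rw [real_inner_smul_right, horth, mul_zero]

end Lorentz

/-! ## §2 Far closure: limits of d.o.c.-part coordinates far from the hole are d.o.c.-part coordinates -/

section FarClosure

variable {𝓑 : StationaryAFBlackHole.{0}} {A : 𝓑.AdaptedChart} {M a c r₀ : ℝ} {Θ : E4 → E4}

/-- `‖x_{space}‖ ≤ r(x) + |a|` on `{r > 0}`. [folklore] -/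
private theorem spatialNorm_le_radius_add_w5 {a : ℝ} {x : E4} (hx : 0 < Kerr.radius a x) :
    E4.spatialNorm x ≤ Kerr.radius a x + |a| := by
  have h := Kerr.norm_le_radius_add_abs (a := a) (y := E4.spatial x) (by rwa [Kerr.radius_ofTimeSpace_spatial])
  rwa [Kerr.radius_ofTimeSpace_spatial] at h

/-- **Far closure.** For `IsKerrChartedWith 𝓑 A M a c r₀ Θ` with `c = 1` there is `Q₀` such that every point of the
closure of `Θ '' Kerr.exterior` of Euclidean spatial norm `≥ Q₀` lies in `Θ '' Kerr.exterior`: a sequence `Θ xₙ → w`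
has `xₙ` bounded (tilt and radius comparisons) with `r(xₙ) ≥ r₊ + 1` eventually, so a subsequence converges to a point
`x̄` of the exterior and `Θ x̄ = w` by continuity. [folklore] -/
theorem kerrChartedWith_far_closure (hW : IsKerrChartedWith 𝓑 A M a c r₀ Θ) (hc1 : c = 1) :
    ∃ Q₀ : ℝ, ∀ w ∈ closure (Θ '' (Kerr.exterior M a : Set E4)), Q₀ ≤ E4.spatialNorm w →
      w ∈ Θ '' (Kerr.exterior M a : Set E4) := by
  obtain ⟨L₁, hL₁0, hL₁⟩ := kerrChartedWith_global_bounds hW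
  obtain ⟨C, hC⟩ := A.exists_abs_radius_sub_spatialNorm_le
  obtain ⟨hsub, -, -, hr₀, hΘs, -, -, -, -, -, L, hL⟩ := hW
  have hrp : 0 < Kerr.rPlus M a := hsub.pos.trans_le (le_add_of_nonneg_right (Real.sqrt_nonneg _))
  refine ⟨Kerr.rPlus M a + |C| + L₁ + 2, fun w hw hQ ↦ ?_⟩
  obtain ⟨ws, hws, hlim⟩ := mem_closure_iff_seq_limit.1 hw
  choose x hx hxw using hws
  -- eventually `Θ xₙ` is within `1` of `w`
  have hnorm : Tendsto (fun n ↦ ‖ws n - w‖) atTop (𝓝 0) := tendsto_iff_norm_sub_tendsto_zero.1 hlim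
  obtain ⟨N, hN⟩ := eventually_atTop.1 (hnorm.eventually (gt_mem_nhds zero_lt_one))
  have hsp : ∀ n, N ≤ n → |E4.spatialNorm (ws n) - E4.spatialNorm w| ≤ 1 := fun n hn ↦
    (E4.abs_spatialNorm_sub_le _ _).trans (hN n hn).le
  have hws1 : ∀ n, N ≤ n → ‖ws n‖ ≤ ‖w‖ + 1 := fun n hn ↦ by linarith [(hN n hn).le, norm_le_insert' (ws n) w]
  -- hence `r(xₙ) ≥ r₊ + 1` and `xₙ` is bounded, for `n ≥ N`
  have hfar : ∀ n, N ≤ n → Kerr.rPlus M a + 1 ≤ Kerr.radius a (x n) := fun n hn ↦ by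
    have h1 := (hL₁ (x n) (hx n)).2.1
    have h2 := (abs_le.1 (hC (Θ (x n)))).1
    have h3 := (abs_le.1 (hsp n hn)).1
    rw [hxw n] at h1 h2
    linarith [le_abs_self C]
  set B : ℝ := 2 * ‖w‖ + 2 + L₁ + |C| + |L| + |a| with hB
  have hbound : ∀ n, N ≤ n → ‖x n‖ ≤ B := fun n hn ↦ by
    have ht := abs_le.1 ((hL₁ (x n) (hx n)).1)
    rw [hc1, one_mul] at ht
    have h0' := abs_le.1 (show |Θ (x n) 0| ≤ ‖ws n‖ by
      rw [hxw n]
      refine abs_le_of_sq_le_sq ?_ (norm_nonneg _)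
      rw [E4.norm_sq_eq_time_sq_add (ws n)]; nlinarith [E4.spatialNorm_nonneg (ws n)])
    have hrad : Kerr.radius a (x n) ≤ A.radius (Θ (x n)) + |L| := by
      have h := (abs_le.1 (hL (x n) (hx n) (hfar n hn)).2.1).1
      linarith [le_abs_self L]
    have hAr : A.radius (Θ (x n)) ≤ E4.spatialNorm (ws n) + |C| := by
      have h := (abs_le.1 (hC (ws n))).2
      rw [hxw n]; linarith [le_abs_self C]
    have hsn : E4.spatialNorm (ws n) ≤ ‖ws n‖ := E4.spatialNorm_le_norm _
    have hsx : E4.spatialNorm (x n) ≤ Kerr.radius a (x n) + |a| :=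
      spatialNorm_le_radius_add_w5 (hrp.trans_le ((le_add_of_nonneg_right zero_le_one).trans (hfar n hn)))
    have hxt : |x n 0| ≤ ‖w‖ + 1 + L₁ := by rw [abs_le]; constructor <;> linarith [hws1 n hn]
    have hxs : E4.spatialNorm (x n) ≤ ‖w‖ + 1 + |C| + |L| + |a| := by linarith [hws1 n hn]
    have h1 : ‖x n‖ ^ 2 ≤ B ^ 2 := by
      rw [E4.norm_sq_eq_time_sq_add (x n), hB]
      nlinarith [abs_nonneg (x n 0), E4.spatialNorm_nonneg (x n), sq_abs (x n 0), norm_nonneg w,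
        abs_nonneg C, abs_nonneg L, abs_nonneg a]
    exact (pow_le_pow_iff_left₀ (norm_nonneg _) (by rw [hB]; positivity) two_ne_zero).1 h1
  -- a convergent subsequence of the shifted sequence `n ↦ x (n + N)`
  obtain ⟨xbar, -, φ, hφ, hconv⟩ := tendsto_subseq_of_bounded (Metric.isBounded_closedBall (x := (0 : E4)) (r := B))
    (x := fun n ↦ x (n + N)) fun n ↦ by
      rw [Metric.mem_closedBall, dist_zero_right]; exact hbound (n + N) (Nat.le_add_left N n)
  -- its limit is a point of the exterior
  have hrbar : Kerr.rPlus M a + 1 ≤ Kerr.radius a xbar :=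
    ge_of_tendsto' (((Kerr.continuous_radius a).tendsto xbar).comp hconv) fun n ↦ hfar (φ n + N) (Nat.le_add_left N _)
  have hxbar : xbar ∈ (Kerr.exterior M a : Set E4) := Kerr.mem_exterior.2 ((max_eq_left hrp.le).trans_lt (by linarith))
  have hxreg : xbar ∈ (Kerr.region a r₀ : Set E4) :=
    Kerr.mem_region.2 ((max_le_max hr₀.le le_rfl).trans_lt (Kerr.mem_exterior.1 hxbar))
  -- continuity of `Θ` at `x̄` and uniqueness of limits
  have hΘc : ContinuousAt Θ xbar := (hΘs.continuousOn.continuousWithinAt hxreg).continuousAt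
    ((Kerr.region a r₀).isOpen.mem_nhds hxreg)
  have h1 : Tendsto (fun n ↦ Θ (x (φ n + N))) atTop (𝓝 (Θ xbar)) := hΘc.tendsto.comp hconv
  have hφN : Tendsto (fun n ↦ φ n + N) atTop atTop := (tendsto_add_atTop_nat N).comp hφ.tendsto_atTop
  have h2 : Tendsto (fun n ↦ Θ (x (φ n + N))) atTop (𝓝 w) :=
    (hlim.comp hφN).congr fun n ↦ show ws (φ n + N) = Θ (x (φ n + N)) from (hxw _).symm
  exact ⟨xbar, hxbar, tendsto_nhds_unique h1 h2⟩

end FarClosure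

/-! ## §3 No hole tilts the time axis -/

section Tilt

variable {𝓢 : Spacetime.{0} 4} {O : Set 𝓢.carrier} {k : ℕ}

/-- **No hole tilts the time axis.** Under clause (iii) of `HasExhaustiveDocCharts'`, a Kerr identification of hole
`i` with `cᵢ = 1`, and the clauses (a), (e⁺) of `IsChartOverlapCompatible`, the pulled-back time axis
`Λᵢ⁻¹ e₀` of the motion of hole `i` has no spatial part (module docstring, THE FINDING). [folklore] -/
theorem spatial_symm_basisVector_eq_zero (d : StationaryFinalStateDecomposition 𝓢 O k) {M a c r₀ : Fin d.N → ℝ}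
    {Θ : Fin d.N → E4 → E4} (R : Fin d.N → ℝ → ℝ) (i : Fin d.N)
    (hiii : ∀ W s₀ : ℝ, ∀ᶠ σ in atTop, d.toOver.chart i '' ({x | (d.background i).time x.1 = σ ∧
      R i (σ - s₀) - W ≤ (d.background i).radius x.1} ∩ docPart d i) ⊆ d.toOver.radiationZone)
    (hW : IsKerrChartedWith (d.hole i) (d.adapted i) (M i) (a i) (c i) (r₀ i) (Θ i)) (hc1 : c i = 1)
    (ha : ∀ (y : (d.background i).domain) (h : (y : E4) ∈ d.toOver.flatDomain),
      d.toOver.τ₀ < (d.background i).time y.1 → d.toOver.τ₀ < (y : E4) 0 → d.toOver.chart i y = d.toOver.flatChart ⟨y, h⟩)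
    (he : ∀ y : d.toOver.flatDomain, d.toOver.τ₀ < (y : E4) 0 →
      ∃ h : (y : E4) ∈ (d.background i).domain, (⟨(y : E4), h⟩ : (d.background i).domain) ∈ docPart d i) :
    E4.spatial (((d.motion i).1 : E4 ≃L[ℝ] E4).symm (E4.basisVector 0)) = 0 := by
  classical
  by_contra hv
  -- notation
  set Λ : lorentzGroup := (d.motion i).1 with hΛ; set c₀ : E4 := (d.motion i).2 with hc₀
  set u0 : ℝ := (Λ : E4 ≃L[ℝ] E4).symm (E4.basisVector 0) 0 with hu0
  set v : E3 := E4.spatial ((Λ : E4 ≃L[ℝ] E4).symm (E4.basisVector 0)) with hv_def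
  have hv2 : 0 < ‖v‖ ^ 2 := by have := norm_pos_iff.2 hv; positivity
  obtain ⟨n, hn1, hvn0⟩ := exists_norm_eq_one_inner_eq_zero_E3 v
  set nh : E4 := E4.ofTimeSpace 0 n with hnh; set vh : E4 := E4.ofTimeSpace 0 v with hvh
  -- constants: radius comparison of every hole, far closure and clause (iii) for hole `i`, `Θᵢ(ext) ⊆ Aᵢ.domain`
  choose Cf hCf using fun j ↦ (d.adapted j).exists_abs_radius_sub_spatialNorm_le
  have hΘdom : ∀ x ∈ (Kerr.exterior (M i) (a i) : Set E4), Θ i x ∈ ((d.adapted i).domain : Set E4) := fun x hx ↦ by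
    obtain ⟨-, -, -, hr₀, -, -, hΘm, -⟩ := hW
    exact hΘm (Kerr.mem_region.2 ((max_le_max hr₀.le le_rfl).trans_lt (Kerr.mem_exterior.1 hx)))
  obtain ⟨Q₀, hQ₀⟩ := kerrChartedWith_far_closure hW hc1
  obtain ⟨Sg, hSg⟩ := eventually_atTop.1 (hiii 0 0)
  set σ : ℝ := max Sg (d.toOver.τ₀ + 1) with hσ
  have hσS : Sg ≤ σ := le_max_left _ _; have hστ : d.toOver.τ₀ < σ := by have := le_max_right Sg (d.toOver.τ₀ + 1); linarith
  -- the parameters of lab time `τ₀ + 1` (start) and `τ₀` (necessarily bad)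
  set lA : ℝ := (u0 * σ + c₀ 0 - (d.toOver.τ₀ + 1)) / ‖v‖ ^ 2 with hlA
  set lS : ℝ := (u0 * σ + c₀ 0 - d.toOver.τ₀) / ‖v‖ ^ 2 with hlS
  have hAS : lA < lS := by rw [hlA, hlS]; exact div_lt_div_of_pos_right (by linarith) hv2
  -- the `Q`-independent parts of the rest-frame coordinates of the start for the other holes
  obtain ⟨g, hg⟩ : ∃ g : Fin d.N → E4, ∀ j, g j = ((d.motion j).1 : E4 ≃L[ℝ] E4).symm
      ((Λ : E4 ≃L[ℝ] E4) (σ • E4.basisVector 0 + lA • vh) + c₀ - (d.motion j).2) := ⟨_, fun j ↦ rfl⟩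
  obtain ⟨m, hm⟩ : ∃ m : Fin d.N → E4, ∀ j, m j = ((d.motion j).1 : E4 ≃L[ℝ] E4).symm ((Λ : E4 ≃L[ℝ] E4) nh) :=
    ⟨_, fun j ↦ rfl⟩
  have hm1 : ∀ j, 1 ≤ E4.spatialNorm (m j) := fun j ↦ by
    refine one_le_spatialNorm_of_bilin_eq_one ?_
    rw [hm, _root_.Summit.FinalStateConjecture.FinalStateConjecture.Theorems.NecksCertifyBargmann.Seam.minkowski_bilin_symm_symm,
      Λ.2 nh nh, hnh, bilin_ofTimeSpace_zero, hn1, one_pow]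
  obtain ⟨Qj, hQj⟩ := Finite.exists_le fun j ↦ ‖g j‖ + |Cf j| + d.toOver.excision j (d.toOver.τ₀ + 1) + 1
  set Q : ℝ := max (max Qj 0) (max Q₀ (R i σ + |Cf i|)) with hQ
  have hQ0 : 0 ≤ Q := (le_max_right _ _).trans (le_max_left _ _); have hQj' : Qj ≤ Q := (le_max_left _ _).trans (le_max_left _ _)
  have hQQ₀ : Q₀ ≤ Q := (le_max_left _ _).trans (le_max_right _ _)
  have hQR : R i σ + |Cf i| ≤ Q := (le_max_right _ _).trans (le_max_right _ _)
  -- the straight coordinate segment in the rest slice `{w⁰ = σ}` and its lab image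
  obtain ⟨w, hw⟩ : ∃ w : ℝ → E4, ∀ t, w t = σ • E4.basisVector 0 + Q • nh + t • vh := ⟨_, fun t ↦ rfl⟩
  obtain ⟨y, hy⟩ : ∃ y : ℝ → E4, ∀ t, y t = (Λ : E4 ≃L[ℝ] E4) (w t) + c₀ := ⟨_, fun t ↦ rfl⟩
  have hwc : Continuous w := by
    rw [show w = fun t ↦ σ • E4.basisVector 0 + Q • nh + t • vh from funext hw]; fun_prop
  have hyc : Continuous y := by
    rw [show y = fun t ↦ (Λ : E4 ≃L[ℝ] E4) (w t) + c₀ from funext hy]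
    exact ((Λ : E4 ≃L[ℝ] E4).continuous.comp hwc).add continuous_const
  have hw0 : ∀ t, w t 0 = σ := fun t ↦ by rw [hw]; simp [hnh, hvh]
  have hwsp : ∀ t, E4.spatial (w t) = Q • n + t • v := fun t ↦ by
    rw [hw, map_add, map_add, map_smul, map_smul, map_smul, E4.spatial_basisVector_zero, hnh, hvh,
      E4.spatial_ofTimeSpace, E4.spatial_ofTimeSpace, smul_zero, zero_add]
  have hlab : ∀ t, y t 0 = u0 * σ + c₀ 0 - t * ‖v‖ ^ 2 := fun t ↦ by
    have h1 : ((Λ : E4 ≃L[ℝ] E4) (w t)) 0 = u0 * σ - t * ‖v‖ ^ 2 := by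
      rw [lorentz_apply_zero_eq, hw0, hwsp, inner_add_right, real_inner_smul_right, real_inner_smul_right, hvn0,
        real_inner_self_eq_norm_sq]; ring
    rw [hy, PiLp.add_apply, h1]; ring
  have hlabA : y lA 0 = d.toOver.τ₀ + 1 := by rw [hlab, hlA, div_mul_cancel₀ _ hv2.ne']; ring
  have hlabS : y lS 0 = d.toOver.τ₀ := by rw [hlab, hlS, div_mul_cancel₀ _ hv2.ne']; ring
  have hPy : ∀ t, poincareInv Λ c₀ (y t) = w t := fun t ↦ by rw [hy]; exact poincareInv_apply_add _ _ _
  have hwQ : ∀ t, Q ≤ E4.spatialNorm (w t) := fun t ↦ by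
    rw [E4.spatialNorm, hwsp]
    have horth : ⟪Q • n, t • v⟫ = 0 := by
      rw [real_inner_smul_left, real_inner_smul_right, real_inner_comm, hvn0]; ring
    have h1 : ‖Q • n + t • v‖ * ‖Q • n + t • v‖ = ‖Q • n‖ * ‖Q • n‖ + ‖t • v‖ * ‖t • v‖ :=
      norm_add_sq_eq_norm_sq_add_norm_sq_real horth
    have h2 : ‖Q • n‖ = Q := by rw [norm_smul, Real.norm_eq_abs, abs_of_nonneg hQ0, hn1, mul_one]
    rw [h2] at h1
    nlinarith [norm_nonneg (Q • n + t • v), norm_nonneg (t • v)]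
  -- rest-frame coordinates of the start for hole `j`
  have hPj : ∀ j, poincareInv (d.motion j).1 (d.motion j).2 (y lA) = Q • m j + g j := fun j ↦ by
    rw [poincareInv, hm, hg, hy, hw]
    have h1 : (Λ : E4 ≃L[ℝ] E4) (σ • E4.basisVector 0 + Q • nh + lA • vh) + c₀ - (d.motion j).2 =
        Q • (Λ : E4 ≃L[ℝ] E4) nh + ((Λ : E4 ≃L[ℝ] E4) (σ • E4.basisVector 0 + lA • vh) + c₀ - (d.motion j).2) := by
      rw [show σ • E4.basisVector 0 + Q • nh + lA • vh = Q • nh + (σ • E4.basisVector 0 + lA • vh) by abel,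
        (Λ : E4 ≃L[ℝ] E4).map_add, (Λ : E4 ≃L[ℝ] E4).map_smul]
      abel
    rw [h1, ((d.motion j).1 : E4 ≃L[ℝ] E4).symm.map_add, ((d.motion j).1 : E4 ≃L[ℝ] E4).symm.map_smul]
  -- §A the start is a point of the mandatory flat set
  have hstartU : y lA ∈ (d.toOver.flatDomain : Set E4) := by
    refine d.toOver.setOf_lt_excision_subset_flatDomain ⟨by rw [hlabA]; linarith, fun j ↦ ?_⟩
    show d.toOver.excision j (y lA 0) < (d.adapted j).radius (poincareInv (d.motion j).1 (d.motion j).2 (y lA))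
    rw [hlabA, hPj]
    have h1 := (abs_le.1 (hCf j (Q • m j + g j))).1
    have h2 : E4.spatialNorm (Q • m j) - ‖g j‖ ≤ E4.spatialNorm (Q • m j + g j) := by
      have h := (abs_le.1 (E4.abs_spatialNorm_sub_le (Q • m j + g j) (Q • m j))).1
      rw [add_sub_cancel_left] at h; linarith
    have h3 : E4.spatialNorm (Q • m j) = Q * E4.spatialNorm (m j) := by
      rw [E4.spatialNorm, map_smul, norm_smul, Real.norm_eq_abs, abs_of_nonneg hQ0]; rfl
    have h4 : Q ≤ E4.spatialNorm (Q • m j) := by rw [h3]; nlinarith [hm1 j]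
    have h5 := hQj j
    linarith [le_abs_self (Cf j), hQj']
  -- §B the bad parameters form a closed set containing `lS`; its infimum `l₁` is a first bad parameter
  set good : ℝ → Prop := fun t ↦ y t ∈ (d.toOver.flatDomain : Set E4) ∧ d.toOver.τ₀ < y t 0 with hgood
  have hgood_open : IsOpen {t | good t} :=
    (d.toOver.flatDomain.isOpen.preimage hyc).inter
      (isOpen_lt continuous_const ((EuclideanSpace.proj (𝕜 := ℝ) (0 : Fin 4)).continuous.comp hyc))
  set F : Set ℝ := Icc lA lS ∩ {t | ¬ good t} with hF
  have hFc : IsClosed F := isClosed_Icc.inter hgood_open.isClosed_compl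
  have hSF : lS ∈ F := ⟨⟨hAS.le, le_rfl⟩, fun h ↦ by have := h.2; rw [hlabS] at this; exact lt_irrefl _ this⟩
  have hFbdd : BddBelow F := ⟨lA, fun t ht ↦ ht.1.1⟩
  set l₁ : ℝ := sInf F with hl₁
  have hl₁F : l₁ ∈ F := hFc.csInf_mem ⟨lS, hSF⟩ hFbdd
  have hAgood : good lA := ⟨hstartU, by rw [hlabA]; linarith⟩
  have hAl₁ : lA < l₁ := lt_of_le_of_ne hl₁F.1.1 fun h ↦ hl₁F.2 (h ▸ hAgood)
  have hgoodI : ∀ t ∈ Ico lA l₁, good t := fun t ht ↦ by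
    by_contra hbad
    have : l₁ ≤ t := csInf_le hFbdd ⟨⟨ht.1, ht.2.le.trans hl₁F.1.2⟩, hbad⟩
    linarith [ht.2]
  -- on `[lA, l₁)` the segment consists of doubly-late d.o.c.-part coordinates of hole `i`
  have hdocI : ∀ t ∈ Ico lA l₁, w t ∈ Θ i '' (Kerr.exterior (M i) (a i) : Set E4) := fun t ht ↦ by
    obtain ⟨hdom, hdoc⟩ := he ⟨y t, (hgoodI t ht).1⟩ (hgoodI t ht).2
    rw [hW.2.2.2.2.2.2.2.2.2.1, ← hPy t]; exact hdoc
  -- §C the end `w l₁` is a far d.o.c.-part coordinate: far closure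
  haveI : (𝓝[Ico lA l₁] l₁).NeBot := by rw [nhdsWithin_Ico_eq_nhdsLT hAl₁]; infer_instance
  have hwlim : Tendsto w (𝓝[Ico lA l₁] l₁) (𝓝 (w l₁)) := hwc.continuousAt.continuousWithinAt
  have hylim : Tendsto y (𝓝[Ico lA l₁] l₁) (𝓝 (y l₁)) := hyc.continuousAt.continuousWithinAt
  have hcl : w l₁ ∈ closure (Θ i '' (Kerr.exterior (M i) (a i) : Set E4)) :=
    mem_closure_of_tendsto hwlim (eventually_nhdsWithin_of_forall hdocI)
  obtain ⟨x₀, hx₀, hΘx₀⟩ := hQ₀ _ hcl (hQQ₀.trans (hwQ l₁))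
  have hdom₀ : poincareInv (d.motion i).1 (d.motion i).2 (y l₁) ∈ ((d.adapted i).domain : Set E4) := by
    rw [hPy, ← hΘx₀]; exact hΘdom x₀ hx₀
  set Y₀ : (d.background i).domain := ⟨y l₁, hdom₀⟩ with hY₀
  have hdoc₀ : Y₀ ∈ docPart d i := by
    have h : Θ i x₀ ∈ Θ i '' (Kerr.exterior (M i) (a i) : Set E4) := mem_image_of_mem _ hx₀
    rw [hW.2.2.2.2.2.2.2.2.2.1, hΘx₀, ← hPy l₁] at h; exact h
  -- §D clause (iii) at the end point: its chart image is a radiation-zone event `Ψ₀ ȳ`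
  have hmem : d.toOver.chart i Y₀ ∈ d.toOver.radiationZone := by
    refine (hSg σ hσS) (mem_image_of_mem _ ⟨⟨show poincareInv Λ c₀ (y l₁) 0 = σ by rw [hPy, hw0], ?_⟩, hdoc₀⟩)
    · show R i (σ - 0) - 0 ≤ (d.adapted i).radius (poincareInv Λ c₀ (y l₁))
      rw [sub_zero, sub_zero, hPy]
      have h1 := (abs_le.1 (hCf i (w l₁))).1
      linarith [hwQ l₁, le_abs_self (Cf i)]
  obtain ⟨ybar, hybar, heq⟩ := hmem
  -- §E the limit argument: `ψᵢ (y t) = Ψ₀ (y t) → ψᵢ (y l₁) = Ψ₀ ȳ` forces `y t → ȳ`, so `ȳ = y l₁`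
  set frestr := ((Minkowski.backgroundOn d.toOver.flatDomain).lateRegion d.toOver.τ₀).restrict d.toOver.flatChart
  -- the hole-chart points along the segment
  obtain ⟨Yf, hYf⟩ : ∃ Yf : ℝ → (d.background i).domain, ∀ t, poincareInv (d.motion i).1 (d.motion i).2 (y t) ∈
      ((d.adapted i).domain : Set E4) → (Yf t : E4) = y t :=
    ⟨fun t ↦ if h : poincareInv (d.motion i).1 (d.motion i).2 (y t) ∈ ((d.adapted i).domain : Set E4)
      then ⟨y t, h⟩ else Y₀, fun t h ↦ by
        have h' : poincareInv (d.motion i).1 (d.motion i).2 (y t) ∈ (d.adapted i).domain := h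
        simp [h']⟩
  have hYfdom : ∀ t ∈ Ico lA l₁, poincareInv (d.motion i).1 (d.motion i).2 (y t) ∈ ((d.adapted i).domain : Set E4) :=
    fun t ht ↦ by
    obtain ⟨x, hx, hxw⟩ := hdocI t ht
    rw [hPy, ← hxw]; exact hΘdom x hx
  have hYf₁ : Yf l₁ = Y₀ := Subtype.ext (hYf l₁ hdom₀)
  have hT1 : Tendsto (fun t ↦ d.toOver.chart i (Yf t)) (𝓝[Ico lA l₁] l₁) (𝓝 (d.toOver.chart i Y₀)) := by
    have hc : Continuous (d.toOver.chart i) := (d.toOver.isLateChart i).contMDiff.continuous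
    have hYlim : Tendsto Yf (𝓝[Ico lA l₁] l₁) (𝓝 Y₀) := by
      rw [tendsto_subtype_rng]
      exact hylim.congr' (eventually_nhdsWithin_of_forall fun t ht ↦ (hYf t (hYfdom t ht)).symm)
    exact (hc.tendsto Y₀).comp hYlim
  -- the flat-chart points along the segment
  obtain ⟨Z, hZ⟩ : ∃ Z : ℝ → (Minkowski.backgroundOn d.toOver.flatDomain).lateRegion d.toOver.τ₀,
      ∀ t, good t → ((Z t).1 : E4) = y t :=
    ⟨fun t ↦ if h : good t then ⟨⟨y t, h.1⟩, h.2⟩ else ⟨ybar, hybar⟩, fun t h ↦ by simp [dif_pos h]⟩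
  have hT2 : ∀ᶠ t in 𝓝[Ico lA l₁] l₁, d.toOver.chart i (Yf t) = frestr (Z t) := by
    refine eventually_nhdsWithin_of_forall fun t ht ↦ ?_
    have hg' := hgoodI t ht
    have hrest : d.toOver.τ₀ < (d.background i).time (Yf t).1 := by
      show d.toOver.τ₀ < poincareInv (d.motion i).1 (d.motion i).2 (Yf t).1 0
      rw [hYf t (hYfdom t ht), hPy, hw0]; exact hστ
    have hlabt : d.toOver.τ₀ < (Yf t : E4) 0 := by rw [hYf t (hYfdom t ht)]; exact hg'.2
    have hU : (Yf t : E4) ∈ d.toOver.flatDomain := by rw [hYf t (hYfdom t ht)]; exact hg'.1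
    rw [ha (Yf t) hU hrest hlabt]
    show d.toOver.flatChart ⟨(Yf t : E4), hU⟩ = d.toOver.flatChart (Z t).1
    congr 1
    exact Subtype.ext (by rw [hZ t hg']; exact hYf t (hYfdom t ht))
  have hT3 : Tendsto (fun t ↦ frestr (Z t)) (𝓝[Ico lA l₁] l₁) (𝓝 (frestr ⟨ybar, hybar⟩)) := by
    rw [show frestr ⟨ybar, hybar⟩ = d.toOver.chart i Y₀ from heq]; exact hT1.congr' hT2
  have hT4 : Tendsto Z (𝓝[Ico lA l₁] l₁) (𝓝 ⟨ybar, hybar⟩) :=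
    d.toOver.isLateChart_flat.isOpenEmbedding.isEmbedding.tendsto_nhds_iff.2 hT3
  have hT5 : Tendsto (fun t ↦ ((Z t).1 : E4)) (𝓝[Ico lA l₁] l₁) (𝓝 (ybar : E4)) :=
    tendsto_subtype_rng.1 (tendsto_subtype_rng.1 hT4)
  have hT6 : Tendsto y (𝓝[Ico lA l₁] l₁) (𝓝 (ybar : E4)) :=
    hT5.congr' (eventually_nhdsWithin_of_forall fun t ht ↦ hZ t (hgoodI t ht))
  have hyeq : y l₁ = (ybar : E4) := tendsto_nhds_unique hylim hT6
  -- so `l₁` is good after all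
  exact hl₁F.2 ⟨by rw [hyeq]; exact ybar.2, by rw [hyeq]; exact hybar⟩

/-- **Registered helper `recutJunction_noTilt`**: under clause (iii), Kerr identifications with `cᵢ = 1` and the
clauses (a), (e⁺) of `IsChartOverlapCompatible`, no motion tilts the time axis: `(Λᵢ⁻¹ e₀)_{space} = 0` for every
hole (the sign `Λᵢ e₀ = e₀` follows with (ℓ) + (e′) in the companion file). [folklore] -/
theorem recutJunction_noTilt : ∀ {𝓢 : Spacetime.{0} 4} {O : Set 𝓢.carrier} {k : ℕ} (d : StationaryFinalStateDecomposition 𝓢 O k) (M a c r₀ : Fin d.N → ℝ) (Θ : Fin d.N → E4 → E4) (R : Fin d.N → ℝ → ℝ), (∀ i, ∀ W s₀ : ℝ, ∀ᶠ σ in atTop, d.toOver.chart i '' ({x | (d.background i).time x.1 = σ ∧ R i (σ - s₀) - W ≤ (d.background i).radius x.1} ∩ docPart d i) ⊆ d.toOver.radiationZone) → (∀ i, IsKerrChartedWith (d.hole i) (d.adapted i) (M i) (a i) (c i) (r₀ i) (Θ i)) → (∀ i, c i = 1) → (∀ (i : Fin d.N) (y : (d.background i).domain) (h : (y : E4) ∈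 d.toOver.flatDomain), d.toOver.τ₀ < (d.background i).time y.1 → d.toOver.τ₀ < (y : E4) 0 → d.toOver.chart i y = d.toOver.flatChart ⟨y, h⟩) → (∀ y : d.toOver.flatDomain, d.toOver.τ₀ < (y : E4) 0 → ∀ i : Fin d.N, ∃ h : (y : E4) ∈ (d.background i).domain, (⟨(y : E4), h⟩ : (d.background i).domain) ∈ docPart d i) → ∀ i : Fin d.N, E4.spatial (((d.motion i).1 : E4 ≃L[ℝ] E4).symm (E4.basisVector 0)) = 0 :=
  fun d _ _ _ _ _ R hiii hW hc1 ha he i ↦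
    spatial_symm_basisVector_eq_zero d R i (hiii i) (hW i) (hc1 i) (ha i) (fun y hy ↦ he y hy i)

end Tilt

end Summit.FinalStateConjecture.FinalStateConjecture.Theorems.SymplecticDualOfTheBomb

end
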